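import Literature.NumberTheory.Transcendental.KZCubicalCalculus
import Literature.NumberTheory.Transcendental.KZLogCalculusProofs
import Literature.NumberTheory.Transcendental.KZSemialgebraicComplex
import Summits.KontsevichZagierPeriods.KontsevichZagierPeriods.Theorems.UnfoldedStokesStokesGenerationStubRungCertificate

/-!
# `StokesGeneration` (stmt-KontsevichZagierPeriods-3586) — line `fibrewise_stokes`, stub `stub_rungClampedDlogCertificate`

Registered rung stub R16 (lead c4) of the line `fibrewise_stokes` of the crux `StokesGeneration`
(route UnfoldedStokes): **the two-element divergence certificate for a logarithmic derivative
with a finite set of algebraic kinks** on the closed square `[0,1]²` (coordinates `z = x 0`,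
`y = x 1`).

This is the landed R2 certificate `stub_rungCertificate` (same primitives, same fibre
derivatives) for a `P > 0` on `[0,1]` with `P 0 = P 1 = 1` that is only CONTINUOUS on `[0,1]` and
differentiable off a finite set `F` of real algebraic points, with a bounded (possibly
discontinuous across `F`) derivative `P'`; `P`, `P'` are `ℚ`-semialgebraic as functions of `x 0`
on the square and `γ` is real algebraic. With `E = 1 + (P z − 1) y > 0` on the square the
primitives are `G₀ = γ (P z − 1)/E` (direction `0`, kink set `K₀ = {x | x 0 ∈ F}`, a finite union
of coordinate hyperplanes at algebraic heights, hence `ℚ`-semialgebraic with finite `0`-fibres)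
and `G₁ = γ y P'(z) (1/P z − 1/E)` (direction `1`, no kinks: `G₁` is smooth in `y`), with fibre
derivatives `D₀ = γ P'(z)/E²` (off `K₀`, R2's quotient rule `rungCert_hasDerivAt_dir0`) and
`D₁ = γ P'(z)(1/P z − 1/E²)` (R2's `rungCert_hasDerivAt_dir1`), `D₀ + D₁ = γ P'/P` pointwise.
All four boundary values `G₀|_{z=1}`, `G₀|_{z=0}`, `G₁|_{y=1}`, `G₁|_{y=0}` vanish
(`P 0 = P 1 = 1`, `E|_{y=1} = P`), so the two fibrewise Stokes elements are carried by the
closed square with integrands `Dⱼ`. Since `P'` may jump, `D₀`, `D₁`, `G₁` are not continuous on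
the square; they are a continuous function times `P'(x 0)`, hence BOUNDED, and bounded
`ℚ`-semialgebraic functions on the compact square are integrable (semialgebraic functions are
measurable). Semialgebraicity of `Gⱼ`, `Dⱼ` is closure of `ℚ`-semialgebraic functions under
field operations (Bochnak–Coste–Roy, Prop. 2.2.6) applied to the atoms `P (x 0)`, `P' (x 0)`,
`x 1`, `γ`, `1`; the kink hyperplanes `{x 0 = c}`, `c` algebraic, are `ℚ`-semialgebraic
(Kontsevich–Zagier allow "algebraic" for "rational").

References: J. Ayoub, *Une version relative de la conjecture des périodes de Kontsevich–Zagier*,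
Ann. of Math. 181 (2015), Rem. 1.5; M. Kontsevich, D. Zagier, *Periods* (2001), §1.1–1.2;
J. Bochnak, M. Coste, M.-F. Roy, *Real Algebraic Geometry* (1998), Prop. 2.2.6.
-/

noncomputable section

-- `Summit.KontsevichZagierPeriods.KontsevichZagierPeriods.…` is the tree's mandated layout (single-conjunct summit).
set_option linter.dupNamespace false

namespace Summit.KontsevichZagierPeriods.KontsevichZagierPeriods.Cruxes.StokesGeneration.FibrewiseStokes

open MeasureTheory Set
open Literature.NumberTheory.Transcendental
open Literature.NumberTheory.Transcendental.KZ
open Literature.ModelTheory.ExponentialFields (IsSemialgebraic)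

/-! ## The kink set -/

/-- A finite union of coordinate hyperplanes `{x | x j = c}` at real ALGEBRAIC heights `c ∈ F` is
`ℚ`-semialgebraic (each hyperplane is, Kontsevich–Zagier 2001 §1.1: "rational" may be replaced by
"algebraic"; finite unions of semialgebraic sets are semialgebraic).
[cite: KontsevichZagier2001, §1.1] -/
theorem rungClampedDlog_isSemialgebraic_kinks {m : ℕ} (F : Finset ℝ)
    (hF : ∀ c ∈ F, IsAlgebraic ℚ c) (j : Fin m) :
    IsSemialgebraic ℚ {x : Fin m → ℝ | x j ∈ F} := by
  have h : {x : Fin m → ℝ | x j ∈ F} = ⋃ c ∈ F, {x : Fin m → ℝ | x j = c} := by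
    ext x
    simp only [mem_setOf_eq, mem_iUnion, exists_prop, exists_eq_right']
  rw [h]
  exact Literature.ModelTheory.ExponentialFields.IsSemialgebraic.biUnion F _ fun c hc =>
    isSemialgebraic_setOf_apply_eq_of_isAlgebraic (hF c hc) j

/-! ## The certificate -/

/-- **Registered stub `stub_rungClampedDlogCertificate` (R16): the two-element divergence
certificate for a logarithmic derivative with finitely many algebraic kinks.** If `P > 0` on
`[0,1]`, `P(0) = P(1) = 1`, `P` is continuous on `[0,1]` and differentiable off a finite set `F`
of real algebraic points with bounded derivative `P'`, both `ℚ`-semialgebraic (as functions of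
`x 0` on the square), and `γ` is real algebraic, then `γ · P'/P` (a function of `x 0` on `[0,1]²`,
off `F`) is the sum of two fibrewise Stokes elements with primitives
`G₀ = γ (P − 1)/(1 + (P − 1) x₁)` (direction `0`, kink set `{x | x 0 ∈ F}`) and
`G₁ = γ x₁ P' (1/P − 1/(1 + (P − 1) x₁))` (direction `1`, no kinks); all four boundary terms
vanish and `∂₀ G₀ + ∂₁ G₁ = γ P'/P`. The integrands are bounded `ℚ`-semialgebraic, hence
integrable on the square. Proof: R2 (`stub_rungCertificate`, p124720) with kinks.
[cite: Ayoub2015, Rem. 1.5] -/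
theorem stub_rungClampedDlogCertificate :
    ∀ (γ : ℝ) (P P' : ℝ → ℝ) (F : Finset ℝ), IsAlgebraic ℚ γ → (∀ c ∈ F, IsAlgebraic ℚ c) →
      IsSemialgebraicFunOn ℚ (Set.pi Set.univ (fun _ : Fin 2 => Set.Icc (0:ℝ) 1)) (fun x => P (x 0)) →
      IsSemialgebraicFunOn ℚ (Set.pi Set.univ (fun _ : Fin 2 => Set.Icc (0:ℝ) 1)) (fun x => P' (x 0)) →
      (∀ u ∈ Set.Icc (0:ℝ) 1, 0 < P u) → P 0 = 1 → P 1 = 1 →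
      ContinuousOn P (Set.Icc (0:ℝ) 1) → (∃ B : ℝ, ∀ u ∈ Set.Icc (0:ℝ) 1, |P' u| ≤ B) →
      (∀ u ∈ Set.Ioo (0:ℝ) 1, u ∉ F → HasDerivAt P (P' u) u) →
      ∃ (G D : Fin 2 → (Fin 2 → ℝ) → ℝ) (K : Fin 2 → Set (Fin 2 → ℝ)) (q : Fin 2 → IntegralRep 2),
        (∀ j, IsSemialgebraicFunOn ℚ (Set.pi Set.univ (fun _ : Fin 2 => Set.Icc (0:ℝ) 1)) (G j) ∧
          IsSemialgebraicFunOn ℚ (Set.pi Set.univ (fun _ : Fin 2 => Set.Icc (0:ℝ) 1)) (D j) ∧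
          IsSemialgebraic ℚ (K j) ∧
          (∃ B : ℝ, ∀ x ∈ Set.pi Set.univ (fun _ : Fin 2 => Set.Icc (0:ℝ) 1), |(G j) x| ≤ B) ∧
          (∀ x ∈ Set.pi Set.univ (fun _ : Fin 2 => Set.Icc (0:ℝ) 1), Set.Finite {s : ℝ | Function.update x j s ∈ (K j)}) ∧
          (∀ x ∈ Set.pi Set.univ (fun _ : Fin 2 => Set.Icc (0:ℝ) 1),
            ContinuousOn (fun s : ℝ => (G j) (Function.update x j s)) (Set.Icc (0:ℝ) 1)) ∧
          (∀ x ∈ Set.pi Set.univ (fun _ : Fin 2 => Set.Icc (0:ℝ) 1), x ∉ (K j) → x j ∈ Set.Ioo (0:ℝ) 1 →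
            HasDerivAt (fun s : ℝ => (G j) (Function.update x j s)) ((D j) x) (x j))) ∧
        (∀ j, (q j).domain = Set.pi Set.univ (fun _ : Fin 2 => Set.Icc (0:ℝ) 1) ∧
          ∀ x ∈ Set.pi Set.univ (fun _ : Fin 2 => Set.Icc (0:ℝ) 1), (q j).integrand x =
            D j x - (G j (Function.update x j 1) - G j (Function.update x j 0))) ∧
        ∀ x ∈ Set.pi Set.univ (fun _ : Fin 2 => Set.Icc (0:ℝ) 1), x 0 ∉ F →
          γ * (P' (x 0) / P (x 0)) = ∑ j, (q j).integrand x := by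
  intro γ P P' F hγ hF hP hP' hpos hP0 hP1 hPc hbdP' hder
  obtain ⟨B, hB⟩ := hbdP'
  -- the closed square and what holds on it
  set S : Set (Fin 2 → ℝ) := Set.pi Set.univ (fun _ : Fin 2 => Set.Icc (0:ℝ) 1) with hS
  have hSsa : IsSemialgebraic ℚ S := by rw [hS, ← cube_eq_pi]; exact isSemialgebraic_cube
  have hSc : IsCompact S := isCompact_univ_pi fun _ => isCompact_Icc
  have hSmeas : MeasurableSet S := hSc.isClosed.measurableSet
  have h10 : (1 : Fin 2) ≠ 0 := by decide
  have h01 : (0 : Fin 2) ≠ 1 := by decide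
  have hmem : ∀ x ∈ S, ∀ i, x i ∈ Set.Icc (0:ℝ) 1 := fun x hx i => (Set.mem_univ_pi.mp hx) i
  have hPpos : ∀ x ∈ S, 0 < P (x 0) := fun x hx => hpos _ (hmem x hx 0)
  have hPne : ∀ x ∈ S, P (x 0) ≠ 0 := fun x hx => (hPpos x hx).ne'
  have hEpos2 : ∀ s t : ℝ, s ∈ Set.Icc (0:ℝ) 1 → t ∈ Set.Icc (0:ℝ) 1 → 0 < 1 + (P s - 1) * t := by
    intro s t hs ht
    have hp := hpos s hs
    rcases le_total 1 (P s) with h | h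
    · nlinarith [mul_nonneg (sub_nonneg.2 h) ht.1]
    · nlinarith [mul_nonneg (sub_nonneg.2 h) (sub_nonneg.2 ht.2)]
  have hEpos : ∀ x ∈ S, 0 < 1 + (P (x 0) - 1) * x 1 := fun x hx =>
    hEpos2 _ _ (hmem x hx 0) (hmem x hx 1)
  have hEne : ∀ x ∈ S, 1 + (P (x 0) - 1) * x 1 ≠ 0 := fun x hx => (hEpos x hx).ne'
  have hE2ne : ∀ x ∈ S, (1 + (P (x 0) - 1) * x 1) ^ 2 ≠ 0 := fun x hx =>
    pow_ne_zero 2 (hEne x hx)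
  -- moving one coordinate inside `[0,1]` stays in the square
  have hupd : ∀ x ∈ S, ∀ (j : Fin 2), ∀ s ∈ Set.Icc (0:ℝ) 1, Function.update x j s ∈ S := by
    intro x hx j s hs
    refine Set.mem_univ_pi.mpr fun i => ?_
    rcases eq_or_ne i j with rfl | hij
    · simpa using hs
    · rw [Function.update_of_ne hij]
      exact hmem x hx i
  -- semialgebraic atoms on the square
  have hx1sa : IsSemialgebraicFunOn ℚ S (fun x => x 1) := isSemialgebraicFunOn_apply hSsa 1
  have hγsa : IsSemialgebraicFunOn ℚ S (fun _ => γ) :=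
    isSemialgebraicFunOn_const_of_isAlgebraic hSsa hγ
  have h1sa : IsSemialgebraicFunOn ℚ S (fun _ => (1:ℝ)) :=
    isSemialgebraicFunOn_const_of_isAlgebraic hSsa isAlgebraic_one
  have hEsa : IsSemialgebraicFunOn ℚ S (fun x => 1 + (P (x 0) - 1) * x 1) :=
    h1sa.fun_add ((hP.fun_sub h1sa).fun_mul hx1sa)
  -- continuity atoms on the square (only `P` is continuous; `P'` may jump across `F`)
  have hPS : ContinuousOn (fun x : Fin 2 → ℝ => P (x 0)) S :=
    hPc.comp (continuous_apply 0).continuousOn fun x hx => hmem x hx 0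
  have hx1S : ContinuousOn (fun x : Fin 2 → ℝ => x 1) S := (continuous_apply 1).continuousOn
  have hES : ContinuousOn (fun x : Fin 2 → ℝ => 1 + (P (x 0) - 1) * x 1) S :=
    continuousOn_const.fun_add ((hPS.fun_sub continuousOn_const).fun_mul hx1S)
  have hE2S : ContinuousOn (fun x : Fin 2 → ℝ => (1 + (P (x 0) - 1) * x 1) ^ 2) S :=
    hES.pow 2
  -- the witnesses (R2's formulas)
  set G0 : (Fin 2 → ℝ) → ℝ := fun x => γ * (P (x 0) - 1) / (1 + (P (x 0) - 1) * x 1) with hG0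
  set D0 : (Fin 2 → ℝ) → ℝ := fun x => γ * P' (x 0) / (1 + (P (x 0) - 1) * x 1) ^ 2 with hD0
  set G1 : (Fin 2 → ℝ) → ℝ := fun x =>
    γ * x 1 * P' (x 0) * (1 / P (x 0) - 1 / (1 + (P (x 0) - 1) * x 1)) with hG1
  set D1 : (Fin 2 → ℝ) → ℝ := fun x =>
    γ * P' (x 0) * (1 / P (x 0) - 1 / (1 + (P (x 0) - 1) * x 1) ^ 2) with hD1
  -- semialgebraicity (closure under field operations, BCR Prop. 2.2.6)
  have hG0sa : IsSemialgebraicFunOn ℚ S G0 := (hγsa.fun_mul (hP.fun_sub h1sa)).div hEsa hEne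
  have hD0sa : IsSemialgebraicFunOn ℚ S D0 := (hγsa.fun_mul hP').div (hEsa.fun_pow 2) hE2ne
  have hG1sa : IsSemialgebraicFunOn ℚ S G1 :=
    ((hγsa.fun_mul hx1sa).fun_mul hP').fun_mul
      ((h1sa.div hP hPne).fun_sub (h1sa.div hEsa hEne))
  have hD1sa : IsSemialgebraicFunOn ℚ S D1 :=
    (hγsa.fun_mul hP').fun_mul ((h1sa.div hP hPne).fun_sub (h1sa.div (hEsa.fun_pow 2) hE2ne))
  -- continuity of `G₀` and of the continuous cofactors of `P' (x 0)` in `D₀`, `G₁`, `D₁`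
  have hG0c : ContinuousOn G0 S :=
    (continuousOn_const.fun_mul (hPS.fun_sub continuousOn_const)).div₀ hES hEne
  have hD0cc : ContinuousOn (fun x : Fin 2 → ℝ => γ / (1 + (P (x 0) - 1) * x 1) ^ 2) S :=
    continuousOn_const.div₀ hE2S hE2ne
  have hG1cc : ContinuousOn (fun x : Fin 2 → ℝ =>
      γ * x 1 * (1 / P (x 0) - 1 / (1 + (P (x 0) - 1) * x 1))) S :=
    (continuousOn_const.fun_mul hx1S).fun_mul
      ((continuousOn_const.div₀ hPS hPne).fun_sub (continuousOn_const.div₀ hES hEne))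
  have hD1cc : ContinuousOn (fun x : Fin 2 → ℝ =>
      γ * (1 / P (x 0) - 1 / (1 + (P (x 0) - 1) * x 1) ^ 2)) S :=
    continuousOn_const.fun_mul
      ((continuousOn_const.div₀ hPS hPne).fun_sub (continuousOn_const.div₀ hE2S hE2ne))
  -- bounds on the compact square: a continuous function times the bounded `P' (x 0)`
  have hbd : ∀ (Φ f : (Fin 2 → ℝ) → ℝ), ContinuousOn f S → (∀ x ∈ S, Φ x = f x * P' (x 0)) →
      ∃ M : ℝ, ∀ x ∈ S, |Φ x| ≤ M := by
    intro Φ f hf hΦ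
    obtain ⟨M, hM⟩ := hSc.exists_bound_of_continuousOn hf
    refine ⟨M * B, fun x hx => ?_⟩
    have h1 : |f x| ≤ M := by simpa only [Real.norm_eq_abs] using hM x hx
    rw [hΦ x hx, abs_mul]
    exact mul_le_mul h1 (hB _ (hmem x hx 0)) (abs_nonneg _) ((abs_nonneg _).trans h1)
  have hG0bd : ∃ M : ℝ, ∀ x ∈ S, |G0 x| ≤ M := by
    obtain ⟨M, hM⟩ := hSc.exists_bound_of_continuousOn hG0c
    exact ⟨M, fun x hx => by simpa only [Real.norm_eq_abs] using hM x hx⟩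
  have hD0bd : ∃ M : ℝ, ∀ x ∈ S, |D0 x| ≤ M := hbd D0 _ hD0cc fun x _ => by
    simp only [hD0]
    ring
  have hG1bd : ∃ M : ℝ, ∀ x ∈ S, |G1 x| ≤ M := hbd G1 _ hG1cc fun x _ => by
    simp only [hG1]
    ring
  have hD1bd : ∃ M : ℝ, ∀ x ∈ S, |D1 x| ≤ M := hbd D1 _ hD1cc fun x _ => by
    simp only [hD1]
    ring
  -- integrability of bounded semialgebraic functions on the square
  have hint : ∀ Φ : (Fin 2 → ℝ) → ℝ, IsSemialgebraicFunOn ℚ S Φ → (∃ M : ℝ, ∀ x ∈ S, |Φ x| ≤ M) →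
      IntegrableOn Φ S := by
    rintro Φ hΦ ⟨M, hM⟩
    exact IntegrableOn.of_bound hSc.measure_lt_top
      (aestronglyMeasurable_of_isSemialgebraicFunOn hΦ hSmeas) M
      (ae_restrict_of_forall_mem hSmeas fun x hx => by rw [Real.norm_eq_abs]; exact hM x hx)
  -- packaged as `Fin 2`-families
  set G : Fin 2 → (Fin 2 → ℝ) → ℝ := ![G0, G1] with hG
  set D : Fin 2 → (Fin 2 → ℝ) → ℝ := ![D0, D1] with hD
  set K : Fin 2 → Set (Fin 2 → ℝ) := ![{x | x 0 ∈ F}, ∅] with hK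
  have hGsa : ∀ j, IsSemialgebraicFunOn ℚ S (G j) := Fin.forall_fin_two.2 ⟨hG0sa, hG1sa⟩
  have hDsa : ∀ j, IsSemialgebraicFunOn ℚ S (D j) := Fin.forall_fin_two.2 ⟨hD0sa, hD1sa⟩
  have hKsa : ∀ j, IsSemialgebraic ℚ (K j) :=
    Fin.forall_fin_two.2 ⟨rungClampedDlog_isSemialgebraic_kinks F hF 0,
      Literature.ModelTheory.ExponentialFields.isSemialgebraic_empty⟩
  have hGbd : ∀ j, ∃ M : ℝ, ∀ x ∈ S, |G j x| ≤ M := Fin.forall_fin_two.2 ⟨hG0bd, hG1bd⟩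
  have hDint : ∀ j, IntegrableOn (D j) S :=
    Fin.forall_fin_two.2 ⟨hint D0 hD0sa hD0bd, hint D1 hD1sa hD1bd⟩
  -- all four boundary values vanish identically
  have hG_one : ∀ j x, G j (Function.update x j 1) = 0 := by
    refine Fin.forall_fin_two.2 ⟨fun x => ?_, fun x => ?_⟩
    · simp only [hG, hG0, Matrix.cons_val_zero, Function.update_self, hP1]
      ring
    · simp only [hG, hG1, Matrix.cons_val_one, Matrix.cons_val_fin_one, Function.update_self,
        Function.update_of_ne h01]
      ring
  have hG_zero : ∀ j x, G j (Function.update x j 0) = 0 := by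
    refine Fin.forall_fin_two.2 ⟨fun x => ?_, fun x => ?_⟩
    · simp only [hG, hG0, Matrix.cons_val_zero, Function.update_self, hP0]
      ring
    · simp only [hG, hG1, Matrix.cons_val_one, Matrix.cons_val_fin_one, Function.update_self]
      ring
  -- the fibre functions
  have hG0fun : ∀ x : Fin 2 → ℝ, (fun s : ℝ => G 0 (Function.update x 0 s)) =
      fun s => γ * (P s - 1) / (1 + (P s - 1) * x 1) := fun x => by
    funext s
    simp only [hG, hG0, Matrix.cons_val_zero, Function.update_self, Function.update_of_ne h10]
  have hG1fun : ∀ x : Fin 2 → ℝ, (fun s : ℝ => G 1 (Function.update x 1 s)) =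
      fun s => γ * s * P' (x 0) * (1 / P (x 0) - 1 / (1 + (P (x 0) - 1) * s)) := fun x => by
    funext s
    simp only [hG, hG1, Matrix.cons_val_one, Matrix.cons_val_fin_one, Function.update_self,
      Function.update_of_ne h01]
  -- finiteness of the kink fibres
  have hKfin : ∀ j, ∀ x ∈ S, Set.Finite {s : ℝ | Function.update x j s ∈ K j} := by
    refine Fin.forall_fin_two.2 ⟨fun x _ => ?_, fun x _ => ?_⟩
    · refine F.finite_toSet.subset fun s hs => ?_
      simp only [hK, Matrix.cons_val_zero, mem_setOf_eq, Function.update_self] at hs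
      exact Finset.mem_coe.2 hs
    · simp [hK]
  -- continuity along closed fibres
  have hGfib : ∀ j, ∀ x ∈ S,
      ContinuousOn (fun s : ℝ => G j (Function.update x j s)) (Set.Icc (0:ℝ) 1) := by
    refine Fin.forall_fin_two.2 ⟨fun x hx => ?_, fun x hx => ?_⟩
    · have hc : Continuous fun s : ℝ => Function.update x 0 s :=
        continuous_const.update 0 continuous_id
      exact hG0c.comp hc.continuousOn fun s hs => hupd x hx 0 s hs
    · rw [hG1fun x]
      exact ((continuousOn_const.fun_mul continuousOn_id).fun_mul continuousOn_const).fun_mul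
        (continuousOn_const.fun_sub (continuousOn_const.div₀
          (continuousOn_const.fun_add (continuousOn_const.fun_mul continuousOn_id))
          fun s hs => (hEpos2 (x 0) s (hmem x hx 0) hs).ne'))
  -- derivatives along open fibres, off the kink set
  have hGder : ∀ j, ∀ x ∈ S, x ∉ K j → x j ∈ Set.Ioo (0:ℝ) 1 →
      HasDerivAt (fun s : ℝ => G j (Function.update x j s)) (D j x) (x j) := by
    refine Fin.forall_fin_two.2 ⟨fun x hx hxK hx0 => ?_, fun x hx _ _ => ?_⟩
    · have hxF : x 0 ∉ F := by
        simpa only [hK, Matrix.cons_val_zero, mem_setOf_eq] using hxK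
      have hDx : D 0 x = γ * P' (x 0) / (1 + (P (x 0) - 1) * x 1) ^ 2 := by
        simp only [hD, hD0, Matrix.cons_val_zero]
      rw [hG0fun x, hDx]
      exact rungCert_hasDerivAt_dir0 (hder _ hx0 hxF) (hEne x hx)
    · have hDx : D 1 x = γ * P' (x 0) * (1 / P (x 0) - 1 / (1 + (P (x 0) - 1) * x 1) ^ 2) := by
        simp only [hD, hD1, Matrix.cons_val_one, Matrix.cons_val_fin_one]
      rw [hG1fun x, hDx]
      exact rungCert_hasDerivAt_dir1 (hEne x hx)
  -- the two closed-square representations, with integrands `D j`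
  let q : Fin 2 → IntegralRep 2 := fun j =>
    { domain := S
      integrand := D j
      isSemialgebraic_domain := hSsa
      isSemialgebraicFunOn_integrand := hDsa j
      integrableOn := hDint j }
  refine ⟨G, D, K, q, fun j => ⟨hGsa j, hDsa j, hKsa j, hGbd j, hKfin j, hGfib j, hGder j⟩,
    fun j => ⟨rfl, fun x _ => ?_⟩, fun x _ _ => ?_⟩
  · -- the integrand clause: boundary terms vanish
    show D j x = D j x - (G j (Function.update x j 1) - G j (Function.update x j 0))
    rw [hG_one, hG_zero, sub_zero, sub_zero]
  · -- the identity `γ P'/P = D₀ + D₁` (pointwise algebra, valid on and off `F`)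
    show γ * (P' (x 0) / P (x 0)) = ∑ j, D j x
    rw [Fin.sum_univ_two]
    simp only [hD, hD0, hD1, Matrix.cons_val_zero, Matrix.cons_val_one, Matrix.cons_val_fin_one]
    ring

end Summit.KontsevichZagierPeriods.KontsevichZagierPeriods.Cruxes.StokesGeneration.FibrewiseStokes
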